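import Summits.AnomalousDissipation.AnomalousDissipation.Theses.LimitingAbsorption
import Summits.AnomalousDissipation.AnomalousDissipation.Theorems.LimitingAbsorptionRelaxationBoundsInventorySuperposition
import Summits.AnomalousDissipation.AnomalousDissipation.Theorems.LimitingAbsorptionRelaxationBoundsInventoryELpNormDecay
import Summits.AnomalousDissipation.AnomalousDissipation.Theorems.LimitingAbsorptionRelaxationBoundsInventoryRiemannSource
import Summits.AnomalousDissipation.AnomalousDissipation.Theorems.LimitingAbsorptionRelaxationBoundsInventoryForcedOfWeakIdentity
import Summits.AnomalousDissipation.AnomalousDissipation.Theorems.LimitingAbsorptionRelaxationBoundsInventorySliceBoundTransfer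
import Summits.AnomalousDissipation.AnomalousDissipation.Theorems.LimitingAbsorptionRelaxationBoundsInventoryLongTimeAvgSupOfAe
import Summits.AnomalousDissipation.AnomalousDissipation.Theorems.LimitingAbsorptionKinematicSteadySourceLawToolkit
import Literature.Analysis.FluidPDE.PassiveScalarExistenceProofs
import Literature.Analysis.FluidPDE.PassiveScalarForcedClass
import Literature.Analysis.FunctionSpaces.SpaceTimeWeakCompactness
import HarnessLib

/-!
# Route LimitingAbsorption — `RelaxationBoundsInventory` (item stmt-AnomalousDissipation-2940): the proof

`relaxationBoundsInventory_proof :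
  Summit.AnomalousDissipation.AnomalousDissipation.Theses.LimitingAbsorption.RelaxationBoundsInventory`.

STATEMENT. For `κ > 0`, a drift `u` essentially bounded on every slab `(0,T) × T²`, a profile
`h ∈ L²(T²)` and the phase-uniform relaxation hypothesis `(U_h)` — every weak solution of the
homogeneous equation `∂ₜΘ + u(s+·)·∇Θ = κΔΘ`, `Θ(0) = h`, obeys `‖Θ(t)‖² ≤ C e^{-γt}‖h‖²` for a.e. `t`,
from every phase `s ≥ 0` — EVERY weak solution `θ` of the sourced problem `∂ₜθ + u·∇θ = κΔθ + h` from
the zero datum has `limsup`-mean inventory `≤ 4C/γ² · ‖h‖²` (in print: Duhamel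
`θ(t) = ∫₀ᵗ U(t,s)h ds` and Minkowski, `‖θ(t)‖ ≤ ∫₀ᵗ √C e^{-γ(t-s)/2}‖h‖ ds ≤ 2√C‖h‖/γ`; Pazy 1983,
Ch. 5 §5.1–5.2; Rowan 2025, Prop. 1.10 (1.15) for the white-forcing twin).

PROOF (line `Sketch` of the crux protocol; the Duhamel integral is realised INSIDE the weak class
`Torus.IsWeakScalarTransportForcedOn`, where no evolution system `U(t,s)` is available). Fix `T > 0`.
1. RELEASES. For every `N` and `k`, a weak solution `Θ_k` of the homogeneous problem with the shifted
   drift `u(kδ + ·)`, `δ = T/(N+1)`, and datum `h` exists on `[0, T - kδ)` (`exists_release`: tree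
   existence `exists_isWeakScalarTransportOn_holds` + the landed shift lemmas of `…InventoryShift`);
   by `(U_h)` it decays, `‖Θ_k(τ)‖_{L²} ≤ √C e^{-γτ/2} √(scalarL2Sq h)` (`stub_eLpNormDecay`).
2. SUPERPOSITION (landed, `…InventorySuperposition`). `W_N = ∑_{k ≤ N} δ Λ_k` (releases placed in
   absolute time) is measurable, bounded in `L^∞_t L²_x` by `M_n = √C√(scalarL2Sq h)(2/γ + T/(n+1))`
   for all `N ≥ n` (Minkowski + `sum_step_mul_exp_le`), and solves the sourced weak identity with the
   Riemann-sum source `∑_k δ ∫ h ψ(kδ)` (`integral_superposition_mul_weakIntegrand`).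
3. `N → ∞`. Weak-* sequential compactness in `L^∞(0,T;L²)`
   (`FunctionSpaces.Torus.exists_strictMono_weakLimit_of_lintegral_sq_le`) extracts from the tail
   `(W_{n+j})_j` a limit `W` with slice bound `M_n²`; the identity is LINEAR in `W_N` and the weak-form
   integrand is square integrable (`exists_bound_weakIntegrand`), so it passes to the limit, the source
   term by `stub_riemannSource`; `stub_forcedOfWeakIdentity` packages `W` as a sourced weak solution
   from the zero datum.
4. UNIQUENESS. Sourced weak solutions with bounded drift are unique (landed
   `KinematicSteadySourceLaw.forced_ae_eq_of_memLp_top`), so `θ` inherits the slice bound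
   (`stub_sliceBoundTransfer`): `scalarL2Sq (θ t) ≤ M_n²` for a.e. `t ∈ (0,T)`, every `n`; letting
   `n → ∞` (`le_sq_of_forall`) gives `scalarL2Sq (θ t) ≤ 4C/γ² · scalarL2Sq h` a.e. on `(0,T)`
   (`inventory_ae_le`).
5. An a.e. bound on every `(0,T)` bounds every running mean, hence the `limsup`
   (`stub_longTimeAvgSupOfAe`).
No joint `(s,t)`-measurability of the release family is ever used (finitely many releases per `N`;
the limit lives in `L²_{t,x}`), and only `L^∞` drift enters (energy-class uniqueness).

## References

* A. Pazy, *Semigroups of Linear Operators and Applications to PDE* (Springer 1983), Ch. 5,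
  §5.1–5.2 (evolution systems, mild solutions of the inhomogeneous problem). [`Pazy1983`]
* K. Rowan, arXiv:2512.02853 (2025), Def. 1.9, Prop. 1.10, (1.15). [`Rowan2025`]
* R. J. DiPerna, P.-L. Lions, Invent. Math. 98 (1989), §II.1. [`DiPernaLions1989`]
* H. Brezis, *Functional Analysis* (2011), Cor. 3.30 (weak-* compactness). [`Brezis2011`]
-/

noncomputable section

open MeasureTheory Set Filter Function TopologicalSpace Topology
open scoped ENNReal NNReal InnerProductSpace BigOperators

namespace Summit.AnomalousDissipation.AnomalousDissipation.Theorems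

-- D-0017: single-problem summit ⇒ `Summit.AnomalousDissipation.AnomalousDissipation.…` by design.
set_option linter.dupNamespace false

open Literature.Analysis Literature.Analysis.FluidPDE Literature.Analysis.FluidPDE.Torus
open RelaxationBoundsInventory.ELpNormDecay RelaxationBoundsInventory.RiemannSource
open RelaxationBoundsInventory.ForcedOfWeakIdentity RelaxationBoundsInventory.SliceBoundTransfer
open RelaxationBoundsInventory.LongTimeAvgSupOfAe

namespace LapInventory

variable {d : Type*} [Fintype d]

/-! ## Releases and the elementary limit -/

/-- **Releases exist at every phase.** For `κ > 0`, a drift bounded and a.e. weakly divergence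
free on `(0,T) × T^d` and a profile `h ∈ L²`, the homogeneous problem with the shifted drift
`u(a + ·)` and datum `h` has a weak solution on `[0, T - a)` for every `a ≥ 0` (tree existence
`exists_isWeakScalarTransportOn_holds` after the landed shift lemmas). [folklore] -/
theorem exists_release {T κ : ℝ} (hκ : 0 < κ) {u : ℝ → UnitAddTorus d → EuclideanSpace ℝ d}
    (hu : MemLp (FunctionSpaces.Torus.stLift u) ⊤ (volume.restrict (Ioo 0 T ×ˢ univ)))
    (hdiv : ∀ᵐ t ∂(volume.restrict (Ioo 0 T)), FunctionSpaces.Torus.IsWeaklyDivFree (u t))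
    {h : UnitAddTorus d → ℝ} (hh : MemLp h 2 volume) {a : ℝ} (ha : 0 ≤ a) :
    ∃ Θ : ℝ → UnitAddTorus d → ℝ, IsWeakScalarTransportOn (T - a) κ (fun t => u (a + t)) h Θ := by
  obtain ⟨Θ, hΘ, -⟩ := exists_isWeakScalarTransportOn_holds hκ hh
    (memLp_top_stLift_comp_const_add ha hu)
    (ae_restrict_Ioo_comp_const_add ha (P := fun t => FunctionSpaces.Torus.IsWeaklyDivFree (u t)) hdiv)
  exact ⟨Θ, hΘ⟩

omit [Fintype d] in
/-- If `x ≤ (a + b/(n+1))²` for every `n : ℕ`, then `x ≤ a²` (let `n → ∞`). [folklore] -/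
theorem le_sq_of_forall {x a b : ℝ}
    (h : ∀ n : ℕ, x ≤ (a + b / (n + 1)) ^ 2) : x ≤ a ^ 2 := by
  have hlim : Tendsto (fun n : ℕ => (a + b / (n + 1)) ^ 2) atTop (𝓝 ((a + 0) ^ 2)) := by
    have h1 : Tendsto (fun n : ℕ => b / ((n : ℝ) + 1)) atTop (𝓝 0) :=
      tendsto_const_nhds.div_atTop (tendsto_natCast_atTop_atTop.atTop_add tendsto_const_nhds)
    exact (tendsto_const_nhds.add h1).pow 2
  rw [add_zero] at hlim
  exact ge_of_tendsto' hlim fun n => h n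

/-- **The inventory bound on every finite horizon.** Under the hypotheses of the crux, for every
`T > 0`: `scalarL2Sq (θ t) ≤ 4C/γ² · scalarL2Sq h` for a.e. `t ∈ (0,T)` (the composition described
in the module docstring). [folklore] -/
theorem inventory_ae_le (κ : ℝ) (u : ℝ → UnitAddTorus (Fin 2) → EuclideanSpace ℝ (Fin 2))
    (h : UnitAddTorus (Fin 2) → ℝ) (C γ : ℝ) (hκ : 0 < κ) (hC : 0 ≤ C) (hγ : 0 < γ)
    (hh : MemLp h 2 volume)
    (hu : ∀ T : ℝ, 0 < T →
      MemLp (FunctionSpaces.Torus.stLift u) ⊤ (volume.restrict (Ioo (0 : ℝ) T ×ˢ univ)))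
    (hU : ∀ s : ℝ, 0 ≤ s → ∀ (T : ℝ) (θ : ℝ → UnitAddTorus (Fin 2) → ℝ),
      IsWeakScalarTransportOn T κ (fun t => u (s + t)) h θ →
        ∀ᵐ t ∂(volume.restrict (Ioo (0 : ℝ) T)),
          scalarL2Sq (θ t) ≤ C * Real.exp (-(γ * t)) * scalarL2Sq h)
    (θ : ℝ → UnitAddTorus (Fin 2) → ℝ) (hθ : IsWeakScalarTransportForced κ u (fun _ => h) 0 θ)
    {T : ℝ} (hT : 0 < T) :
    ∀ᵐ t ∂(volume.restrict (Ioo (0 : ℝ) T)), scalarL2Sq (θ t) ≤ 4 * C / γ ^ 2 * scalarL2Sq h := by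
  have huT := hu T hT
  have hθT : IsWeakScalarTransportForcedOn T κ u (fun _ => h) 0 θ := hθ T hT
  have hdiv := hθT.ae_isWeaklyDivFree
  set A : ℝ := Real.sqrt C with hA
  set σ : ℝ := Real.sqrt (scalarL2Sq h) with hσ
  have hA0 : 0 ≤ A := Real.sqrt_nonneg _
  have hσ0 : 0 ≤ σ := Real.sqrt_nonneg _
  -- releases at all grid phases, for every `N`
  have hrel : ∀ N k : ℕ, ∃ Θ : ℝ → UnitAddTorus (Fin 2) → ℝ,
      IsWeakScalarTransportOn (T - k * (T / (N + 1))) κ (fun t => u (k * (T / (N + 1)) + t)) h Θ := by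
    intro N k
    exact exists_release hκ huT hdiv hh (by positivity)
  choose Θ hΘ using hrel
  -- their decay, from `(U_h)`, in `eLpNorm` currency
  have hbd : ∀ N k : ℕ, ∀ᵐ τ ∂((volume : Measure ℝ).restrict (Ioo 0 (T - k * (T / (N + 1))))),
      eLpNorm (Θ N k τ) 2 volume ≤ ENNReal.ofReal (A * Real.exp (-(γ * τ) / 2) * σ) := by
    intro N k
    have h1 := hU (k * (T / (N + 1))) (by positivity) (T - k * (T / (N + 1))) (Θ N k) (hΘ N k)
    filter_upwards [h1, (hΘ N k).ae_memLp_two] with τ hτ hm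
    exact stub_eLpNormDecay hm hC hτ
  -- the superpositions `W_N`
  set Wsup : ℕ → ℝ → UnitAddTorus (Fin 2) → ℝ := fun N t x => ∑ k ∈ Finset.range (N + 1),
    T / (N + 1) * (if (k : ℝ) * (T / (N + 1)) < t then Θ N k (t - k * (T / (N + 1))) x else 0) with hWsup
  have hWm : ∀ N, AEStronglyMeasurable (FunctionSpaces.Torus.stLift (Wsup N))
      (volume.restrict (Ioo 0 T ×ˢ univ)) := fun N =>
    FunctionSpaces.Torus.aestronglyMeasurable_stLift_of_uncurry
      (aestronglyMeasurable_uncurry_superposition hT.le (hΘ N))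
  have hWeq : ∀ N, ∀ ψ : ℝ → UnitAddTorus (Fin 2) → ℝ, FunctionSpaces.Torus.IsSpaceTimeTest T ψ →
      (∫ t in Ioo 0 T, ∫ x, Wsup N t x *
          (FunctionSpaces.Torus.timeDeriv ψ t x + ⟪u t x, FunctionSpaces.Torus.gradient (ψ t) x⟫_ℝ +
            κ * FunctionSpaces.Torus.laplacian (ψ t) x)) =
        -∑ k ∈ Finset.range (N + 1), T / (N + 1) * ∫ x, h x * ψ (k * (T / (N + 1))) x :=
    fun N ψ hψ => integral_superposition_mul_weakIntegrand hT huT (hΘ N) hψ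
  -- slice bound `M_n` for `N ≥ n`, and the bound for a.e. `t` obtained from the tail `N ≥ n`
  have hmain : ∀ n : ℕ, ∀ᵐ t ∂(volume.restrict (Ioo (0 : ℝ) T)),
      scalarL2Sq (θ t) ≤ (A * σ * (2 / γ + T / (n + 1))) ^ 2 := by
    intro n
    set M : ℝ := A * σ * (2 / γ + T / (n + 1)) with hM
    have hM0 : 0 ≤ M := by positivity
    set B : ℝ≥0 := M.toNNReal ^ 2 with hB
    -- the tail sequence `F j = W_{n+j}`
    set F : ℕ → ℝ → UnitAddTorus (Fin 2) → ℝ := fun j => Wsup (n + j) with hF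
    have hFb : ∀ j, ∀ᵐ t ∂(volume.restrict (Ioo (0 : ℝ) T)), ∫⁻ x, ‖F j t x‖ₑ ^ 2 ≤ B := by
      intro j
      have hMj : A * σ * (2 / γ + T / ((n + j : ℕ) + 1)) ≤ M := by
        rw [hM]
        refine mul_le_mul_of_nonneg_left (add_le_add le_rfl ?_) (mul_nonneg hA0 hσ0)
        refine div_le_div_of_nonneg_left hT.le (by positivity) ?_
        push_cast
        linarith [(Nat.cast_nonneg j : (0 : ℝ) ≤ j)]
      exact ae_lintegral_sq_superposition_le hT hγ hA0 hσ0 (hΘ (n + j)) (hbd (n + j)) hMj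
    -- weak-* limit of the tail
    obtain ⟨φ, hφ, W, hWm', hWb, hlim⟩ :=
      FunctionSpaces.Torus.exists_strictMono_weakLimit_of_lintegral_sq_le (fun j => hWm (n + j)) hFb
    -- the weak identity passes to the limit
    have hWid : ∀ ψ : ℝ → UnitAddTorus (Fin 2) → ℝ, FunctionSpaces.Torus.IsSpaceTimeTest T ψ →
        (∫ t in Ioo 0 T, ∫ x, W t x *
            (FunctionSpaces.Torus.timeDeriv ψ t x + ⟪u t x, FunctionSpaces.Torus.gradient (ψ t) x⟫_ℝ +
              κ * FunctionSpaces.Torus.laplacian (ψ t) x)) =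
          -∫ t in Ioo 0 T, ∫ x, h x * ψ t x := by
      intro ψ hψ
      obtain ⟨-, hGm, -, hG2⟩ := exists_bound_weakIntegrand (κ := κ) huT hψ
      have h1 := hlim _ (FunctionSpaces.Torus.aestronglyMeasurable_stLift_of_uncurry hGm) hG2
      have h2 : Tendsto (fun j => ∫ t in Ioo 0 T, ∫ x, Wsup (n + φ j) t x *
            (FunctionSpaces.Torus.timeDeriv ψ t x + ⟪u t x, FunctionSpaces.Torus.gradient (ψ t) x⟫_ℝ +
              κ * FunctionSpaces.Torus.laplacian (ψ t) x)) atTop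
          (𝓝 (-∫ t in Ioo 0 T, ∫ x, h x * ψ t x)) := by
        have hN : Tendsto (fun j => n + φ j) atTop atTop :=
          tendsto_atTop_mono (fun j => Nat.le_add_left _ _) hφ.tendsto_atTop
        have h3 := (stub_riemannSource hT hh hψ hN).neg
        refine h3.congr fun j => ?_
        exact (hWeq (n + φ j) ψ hψ).symm
      exact tendsto_nhds_unique h1 h2
    -- `W` is a sourced weak solution from the zero datum, with slice bound `B`
    have hW : IsWeakScalarTransportForcedOn T κ u (fun _ => h) 0 W :=
      stub_forcedOfWeakIdentity huT hdiv hh hWm' hWb hWid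
    -- forced uniqueness: the bound is a bound for `θ`
    have h4 := stub_sliceBoundTransfer hκ huT hθT hW hWb
    filter_upwards [h4] with t ht
    refine ht.trans (le_of_eq ?_)
    rw [hB, NNReal.coe_pow, Real.coe_toNNReal _ hM0]
  -- `n → ∞`
  have hall := ae_all_iff.2 hmain
  filter_upwards [hall] with t ht
  have h5 : scalarL2Sq (θ t) ≤ (A * σ * (2 / γ)) ^ 2 := by
    refine le_sq_of_forall (b := A * σ * T) fun n => ?_
    have e : A * σ * (2 / γ) + A * σ * T / (n + 1) = A * σ * (2 / γ + T / (n + 1)) := by ring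
    rw [e]
    exact ht n
  calc scalarL2Sq (θ t) ≤ (A * σ * (2 / γ)) ^ 2 := h5
    _ = 4 * C / γ ^ 2 * scalarL2Sq h := by
        rw [hA, hσ, mul_pow, mul_pow, Real.sq_sqrt hC, Real.sq_sqrt (scalarL2Sq_nonneg h)]
        field_simp
        ring

end LapInventory

/-- **`RelaxationBoundsInventory` (item stmt-AnomalousDissipation-2940, route LimitingAbsorption).**
For `κ > 0`, a drift `u` essentially bounded on every `(0,T) × T²`, a profile `h ∈ L²` and the
phase-uniform relaxation hypothesis `(U_h)` with constants `(C, γ)`, EVERY weak solution of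
`∂ₜθ + u·∇θ = κΔθ + h` from the zero datum has `limsup_T T⁻¹∫₀ᵀ ‖θ(t)‖² dt ≤ 4C/γ² · ‖h‖²`
(Duhamel superposition + Minkowski, realised in the weak class: `LapInventory.inventory_ae_le`,
then `stub_longTimeAvgSupOfAe`). Sources: Pazy 1983, Ch. 5 §5.1–5.2 (mild solutions of the
inhomogeneous problem); Rowan 2025 (arXiv:2512.02853) Prop. 1.10, (1.15) (white-forcing twin).
[folklore] -/
theorem relaxationBoundsInventory_proof :
    Summit.AnomalousDissipation.AnomalousDissipation.Theses.LimitingAbsorption.RelaxationBoundsInventory := by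
  intro κ u h C γ hκ hC hγ hh hu hU θ hθ
  refine stub_longTimeAvgSupOfAe (fun t => scalarL2Sq_nonneg _)
    (mul_nonneg (div_nonneg (by positivity) (by positivity)) (scalarL2Sq_nonneg h)) fun T hT => ?_
  exact LapInventory.inventory_ae_le κ u h C γ hκ hC hγ hh hu hU θ hθ hT

end Summit.AnomalousDissipation.AnomalousDissipation.Theorems

end
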